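import Summits.QuantumFields.BalabanUV.Beta.EriceFlowEnclosureB12AsPrintedHistoryNonuniqueRuns

/-!
# Beta / EriceFlowEnclosureB12AsPrintedHistoryNonuniqueForward — the FORWARD TABLE of (0.20) for a history-dependent β (the run from a
# bare coupling, determined step by step as print defines it) and the smooth last-variable step of the bump family: the two generic
# pieces the toy `Setting` of `…HistoryNonuniqueSetting` needs for the printed `Definitions.d018 ∕ d020 ∕ d213` and `Conclusions.c264`
# (β-flow team, prover 1 = recursion ∕ upper ∕ bare-coupling ∕ uniqueness side, unit `b2b-balaban-beta-bflow-p1`, gen 34; ROW AP-I·C × ROW U;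
# parts `…HistoryNonunique` (letters), `…HistoryNonuniqueRuns` (runs), `…HistoryNonuniqueEnd` (β-level headlines); imports the runs only)

HONEST FRAMING (page 1 of everything the β sub-cell writes): discharging `BetaPertH` makes Bałaban's UV stability UNCONDITIONAL — a
real constructive-QFT result; it is NOT the continuum limit and NOT the Clay problem.  HONEST DEPENDENCY (cell reorg 2026-08-19,
verbatim): «continuum YM on T⁴ ⇐ BetaPertH ∧ nine spine estimates (0/9 proved); BetaPertH ⇐ (D1) ∧ (D4) ∧ CAP+tail; G-an2-4 gates
asym, D1 and NE2/3/4.»  THIS MODULE DISCHARGES NOTHING: [folklore] bookkeeping.  (0.18)∕(0.20) of [I] = T. Bałaban, Commun. Math. Phys.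
**109** (1987) [Balaban1987RG1], pp. 255–256 — *"the coupling constant g_{k+1} is determined from the equation 1∕g_k² = 1∕g²_{k+1} +
β_{k+1}(g_k). (0.20)"*, with p. 298's history dependence — define the run FORWARD from its bare coupling: a table recursion k ↦ (g₀, …, g_k)
(`FlowStep.ys` is the clamped shooting version; here unclamped, stated through DEFINING HYPOTHESES on a table `c k i`, no `def`): §22.  The
smooth step s ↦ Real.smoothTransition(s∕τ) (= 0 at s ≤ 0, = 1 for s ≥ τ, C^∞, values in [0, 1]) is the last-variable factor χ that makes the
bump family history-free at the face g_k = 0 (print's remark after (2.13), `Definitions.d213`) while χ = 1 along run B: §23 gives its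
Lipschitz modulus on [0, γ] (mean value theorem; the constant is not computed) and the p. 264 smoothness schema `BetaSmoothInLast264` for the
family.  Nothing of Bałaban's β is asserted; toys are ours.

WHAT THIS FILE PROVES (0 sorry, 0 def):
§22 THE FORWARD TABLE (any β): `fwd_stable` (rows agree below the diagonal), `fwd_succ` (the diagonal solves (0.20) forward:
    g_{k+1} = (1∕g_k² − β_{k+1}(g₀, …, g_k))^{−1∕2}), **`fwd_d020`** (print's forward determination `Definitions.d020`), **`fwd_eq_of_rgEqH`** (a
    positive solution of (0.20) from the same bare coupling IS the table's diagonal — forward uniqueness).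
§23 THE SMOOTH STEP: `smoothStep_mem_Icc`, `smoothStep_eq_one`, `smoothStep_zero`, `smoothStep_continuous`, **`smoothStep_lipschitzOn`**
    (∃ L ≥ 0, L-Lipschitz on [0, γ]), `section_eq_of_bumpFamily`, **`betaSmoothInLast264_of_bumpFamily`** (p. 264's «smooth on [0, γ]» for the
    family with χ = the smooth step), `gB_ge_start` (run B increases: gᴮ_0 ≤ gᴮ_j, so χ(gᴮ_j) = 1 once τ ≤ gᴮ_0).
§24 `depth_bound` (the x₀-form of #62d's `depth_choice`), **`toyData_exists`**: the parameter choice for the toy `Setting` (depth n, start x₀, amplitude ε, threshold τ, Lipschitz constant L of the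
    step on [0, γ], the two runs, M) with every inequality the `Setting` proof consumes, for PRESCRIBED b, C, C_p, γ and g ∈ ]0, γ], with the
    depth parameter n above any prescribed floor N₀ (for the multi-band recursion of `…HistoryNonuniqueBandsData`).
NOT CLAIMED: anything about Bałaban's β; Theorem 2; `BetaPertH`; continuum; Clay.
-/

namespace Summit.QuantumFields.BalabanUV.Beta.EriceFlowEnclosureB12AsPrintedHistoryNonuniqueForward

open Finset
open Literature.MathematicalPhysics.QuantumFieldTheory.Balaban1983to89
open Literature.MathematicalPhysics.QuantumFieldTheory.Balaban1983to89.FlowStep (HBeta prefixOf Box mem_box RGEqH)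
open Literature.MathematicalPhysics.QuantumFieldTheory.Balaban1983to89.B12CouplingClausesHistory (BetaSmoothInLast264)
open Summit.QuantumFields.BalabanUV.Beta.EriceFlowEnclosureB12AsPrintedHistoryNonuniqueRuns (xA_pos xB_pos inv_sq_gB gB_pos gA_pos M_pos M_ge)

noncomputable section

/-! ## §22 The forward table of (0.20) for a history-dependent β -/

/-- **Rows agree below the diagonal**: if row k + 1 copies row k at the indices i ≤ k, then c k i = c i i for all i ≤ k. [folklore] -/
theorem fwd_stable {β : HBeta} {c : ℕ → ℕ → ℝ}
    (hcs : ∀ k i, c (k + 1) i = if i ≤ k then c k i else 1 / Real.sqrt (1 / (c k k) ^ 2 - β k (fun j : Fin (k + 1) => c k j))) :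
    ∀ k i, i ≤ k → c k i = c i i := by
  intro k
  induction k with
  | zero => intro i hi; obtain rfl := Nat.le_zero.mp hi; rfl
  | succ k ih =>
    intro i hi
    rcases Nat.lt_or_eq_of_le hi with hlt | rfl
    · have hik : i ≤ k := Nat.lt_succ_iff.mp hlt
      rw [hcs k i, if_pos hik, ih i hik]
    · rfl

/-- **The diagonal solves (0.20) FORWARD**: c (k+1) (k+1) = (1∕(c k k)² − β_{k+1}(c 0 0, …, c k k))^{−1∕2}. [cite: Balaban1987RG1, (0.20) p.256 with p.298] -/
theorem fwd_succ {β : HBeta} {c : ℕ → ℕ → ℝ}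
    (hcs : ∀ k i, c (k + 1) i = if i ≤ k then c k i else 1 / Real.sqrt (1 / (c k k) ^ 2 - β k (fun j : Fin (k + 1) => c k j)))
    (k : ℕ) : c (k + 1) (k + 1) = 1 / Real.sqrt (1 / (c k k) ^ 2 - β k (prefixOf (fun i => c i i) k)) := by
  rw [hcs k (k + 1), if_neg (by omega)]
  have hpre : (fun j : Fin (k + 1) => c k j) = prefixOf (fun i => c i i) k := by
    funext j
    rw [FlowStep.prefixOf_apply, fwd_stable hcs k j (Nat.lt_succ_iff.mp j.isLt)]
  rw [hpre]

/-- **PRINT'S FORWARD DETERMINATION (`Definitions.d020`) holds for the diagonal**: whenever 1∕g_k² − β_{k+1}(g₀, …, g_k) > 0, the next coupling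
is positive and (0.20) holds. [cite: Balaban1987RG1, (0.20) p.256] -/
theorem fwd_d020 {β : HBeta} {c : ℕ → ℕ → ℝ}
    (hcs : ∀ k i, c (k + 1) i = if i ≤ k then c k i else 1 / Real.sqrt (1 / (c k k) ^ 2 - β k (fun j : Fin (k + 1) => c k j)))
    (k : ℕ) (hpos : 0 < 1 / (c k k) ^ 2 - β k (prefixOf (fun i => c i i) k)) :
    0 < c (k + 1) (k + 1) ∧ 1 / (c k k) ^ 2 = 1 / (c (k + 1) (k + 1)) ^ 2 + β k (prefixOf (fun i => c i i) k) := by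
  rw [fwd_succ hcs k]
  refine ⟨one_div_pos.mpr (Real.sqrt_pos.mpr hpos), ?_⟩
  rw [one_div_pow, one_div_one_div, Real.sq_sqrt hpos.le]
  ring

/-- **FORWARD UNIQUENESS**: a POSITIVE solution h of (0.20) up to K (`RGEqH K β h`) with the same bare coupling h 0 = c 0 0 coincides with the
table's diagonal at every scale ≤ K (print defines the run by the forward recursion; there is nothing else to be). [cite: Balaban1987RG1, (0.18)–(0.20) pp.255–256] -/
theorem fwd_eq_of_rgEqH {β : HBeta} {c : ℕ → ℕ → ℝ}
    (hcs : ∀ k i, c (k + 1) i = if i ≤ k then c k i else 1 / Real.sqrt (1 / (c k k) ^ 2 - β k (fun j : Fin (k + 1) => c k j)))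
    {K : ℕ} {h : ℕ → ℝ} (h0 : h 0 = c 0 0) (hrg : RGEqH K β h) (hpos : ∀ i, i ≤ K → 0 < h i) :
    ∀ k, k ≤ K → c k k = h k := by
  suffices H : ∀ k, k ≤ K → ∀ j, j ≤ k → c j j = h j from fun k hk => H k hk k le_rfl
  intro k
  induction k with
  | zero => intro _ j hj; obtain rfl := Nat.le_zero.mp hj; exact h0.symm
  | succ k ih =>
    intro hk j hj
    rcases Nat.lt_or_eq_of_le hj with hlt | rfl
    · exact ih (Nat.le_of_succ_le hk) j (Nat.lt_succ_iff.mp hlt)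
    · have ih' := ih (Nat.le_of_succ_le hk)
      have hpre : prefixOf (fun i => c i i) k = prefixOf h k := by
        funext i; simp only [FlowStep.prefixOf_apply]; exact ih' i (Nat.lt_succ_iff.mp i.isLt)
      have hkk : c k k = h k := ih' k le_rfl
      rw [fwd_succ hcs k, hpre, hkk]
      have e := hrg k (Nat.lt_of_succ_le hk)
      have hk1 := hpos (k + 1) hk
      rw [show 1 / (h k) ^ 2 - β k (prefixOf h k) = 1 / (h (k + 1)) ^ 2 by linarith,
        show (1 : ℝ) / (h (k + 1)) ^ 2 = (1 / h (k + 1)) ^ 2 by ring, Real.sqrt_sq (by positivity), one_div_one_div]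

/-! ## §23 The smooth last-variable step and the p. 264 smoothness schema for the bump family -/

/-- The smooth step takes values in [0, 1]. [folklore] -/
theorem smoothStep_mem_Icc (τ s : ℝ) : 0 ≤ Real.smoothTransition (s / τ) ∧ Real.smoothTransition (s / τ) ≤ 1 :=
  ⟨Real.smoothTransition.nonneg _, Real.smoothTransition.le_one _⟩

/-- The smooth step is 1 from τ on (τ > 0). [folklore] -/
theorem smoothStep_eq_one {τ s : ℝ} (hτ : 0 < τ) (hs : τ ≤ s) : Real.smoothTransition (s / τ) = 1 :=
  Real.smoothTransition.one_of_one_le ((one_le_div hτ).mpr hs)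

/-- The smooth step vanishes at 0 (the face g_k = 0). [folklore] -/
theorem smoothStep_zero (τ : ℝ) : Real.smoothTransition (0 / τ) = 0 := by
  rw [zero_div]; exact Real.smoothTransition.zero

/-- The smooth step is continuous. [folklore] -/
theorem smoothStep_continuous (τ : ℝ) : Continuous fun s : ℝ => Real.smoothTransition (s / τ) :=
  Real.smoothTransition.continuous.comp (continuous_id.div_const τ)

/-- The smooth step is C^∞. [folklore] -/
theorem smoothStep_contDiff (τ : ℝ) {m : ℕ∞} : ContDiff ℝ m fun s : ℝ => Real.smoothTransition (s / τ) :=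
  Real.smoothTransition.contDiff.comp (contDiff_id.div_const τ)

/-- **The smooth step is Lipschitz on [0, γ]** with SOME constant L ≥ 0 (its derivative is continuous, hence bounded on the compact interval;
mean value theorem).  The constant is not computed. [folklore] -/
theorem smoothStep_lipschitzOn (τ γ : ℝ) : ∃ L : ℝ, 0 ≤ L ∧ ∀ s t : ℝ, s ∈ Set.Icc (0 : ℝ) γ → t ∈ Set.Icc (0 : ℝ) γ →
    |Real.smoothTransition (s / τ) - Real.smoothTransition (t / τ)| ≤ L * |s - t| := by
  set f : ℝ → ℝ := fun s => Real.smoothTransition (s / τ) with hf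
  have hf1 : ContDiff ℝ 1 f := smoothStep_contDiff τ
  have hdf : Continuous (deriv f) := hf1.continuous_deriv le_rfl
  obtain ⟨L, hL⟩ := isCompact_Icc.exists_bound_of_continuousOn (hdf.continuousOn (s := Set.Icc (0 : ℝ) γ))
  refine ⟨max L 0, le_max_right _ _, fun s t hs ht => ?_⟩
  have hdiff : ∀ x ∈ Set.Icc (0 : ℝ) γ, DifferentiableAt ℝ f x := fun x _ => (hf1.differentiable one_ne_zero).differentiableAt
  have hbound : ∀ x ∈ Set.Icc (0 : ℝ) γ, ‖deriv f x‖ ≤ max L 0 := fun x hx => (hL x hx).trans (le_max_left _ _)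
  have h := (convex_Icc (0 : ℝ) γ).norm_image_sub_le_of_norm_deriv_le hdiff hbound ht hs
  rw [Real.norm_eq_abs, Real.norm_eq_abs] at h
  exact h

/-- Along the family's band the bump does not read the last coordinate: replacing p_k by s leaves Σ_{i<n}(p_i − gᴮ_i) unchanged (n ≤ k).
[folklore] -/
theorem truncSum_update_last {n k : ℕ} (hnk : n ≤ k) (p : Fin (k + 1) → ℝ) (gB : ℕ → ℝ) (s : ℝ) :
    ∑ i : Fin (k + 1), (if (i : ℕ) < n then Function.update p (Fin.last k) s i - gB i else 0)
      = ∑ i : Fin (k + 1), (if (i : ℕ) < n then p i - gB i else 0) := by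
  refine Finset.sum_congr rfl fun i _ => ?_
  split_ifs with hi
  · have hne : i ≠ Fin.last k := by
      intro h; rw [h, Fin.val_last] at hi; omega
    rw [Function.update_of_ne hne]
  · rfl

/-- **The last-variable section of the bump family with the smooth step** at a frozen history p: s ↦ b + 𝟙[band]·ε·m(p)·χ(s) with m(p)
the bump value (free of s). [folklore] -/
theorem section_eq_of_bumpFamily {β : HBeta} {b ε M τ : ℝ} {n : ℕ} {gB : ℕ → ℝ}
    (hβ : ∀ (j : ℕ) (p : Fin (j + 1) → ℝ), β j p = b + (if n ≤ j ∧ j < 2 * n then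
      ε * max (1 - |∑ i : Fin (j + 1), (if (i : ℕ) < n then p i - gB i else 0)| / M) 0 *
        (fun s : ℝ => Real.smoothTransition (s / τ)) (p (Fin.last j)) else 0))
    (k : ℕ) (p : Fin (k + 1) → ℝ) :
    (fun s : ℝ => β k (Function.update p (Fin.last k) s)) = fun s : ℝ => b + (if n ≤ k ∧ k < 2 * n then
      ε * max (1 - |∑ i : Fin (k + 1), (if (i : ℕ) < n then p i - gB i else 0)| / M) 0 * Real.smoothTransition (s / τ) else 0) := by
  funext s
  rw [hβ k]
  by_cases hband : n ≤ k ∧ k < 2 * n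
  · rw [if_pos hband, if_pos hband, truncSum_update_last hband.1 p gB s, Function.update_self]
  · rw [if_neg hband, if_neg hband]

/-- **p. 264's «smooth function defined on the interval [0, γ]» holds for the family with the smooth step** (`BetaSmoothInLast264 γ β`: every
last-variable section at every frozen history is C^∞ on [0, γ] — indeed on ℝ: an affine function of the smooth step). [cite: Balaban1987RG1, p.264 (β-clause after (1.22))] -/
theorem betaSmoothInLast264_of_bumpFamily {β : HBeta} {b ε M τ : ℝ} {n : ℕ} {gB : ℕ → ℝ}
    (hβ : ∀ (j : ℕ) (p : Fin (j + 1) → ℝ), β j p = b + (if n ≤ j ∧ j < 2 * n then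
      ε * max (1 - |∑ i : Fin (j + 1), (if (i : ℕ) < n then p i - gB i else 0)| / M) 0 *
        (fun s : ℝ => Real.smoothTransition (s / τ)) (p (Fin.last j)) else 0))
    (γ : ℝ) : BetaSmoothInLast264 γ β := by
  intro k p _ m
  rw [section_eq_of_bumpFamily hβ k p]
  refine ContDiff.contDiffOn (n := m) ?_
  by_cases hband : n ≤ k ∧ k < 2 * n
  · simp only [hband, and_self, if_true]
    exact contDiff_const.add (contDiff_const.mul (smoothStep_contDiff τ))
  · simp only [hband, if_false, add_zero]
    exact contDiff_const

/-- **Run B increases toward the infrared end**: gᴮ_0 ≤ gᴮ_j for j ≤ 2n (its inverse square x₀ − b·j + ε·(n − (j − n)₊)₊ is at most x₀ + ε·n),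
so the smooth step with threshold τ ≤ gᴮ_0 reads 1 at every coupling of run B. [folklore] -/
theorem gB_ge_start {gB : ℕ → ℝ} {x₀ b ε : ℝ} {n : ℕ} (hB : ∀ i, gB i = 1 / Real.sqrt (x₀ - b * i + ε * ((n - (i - n) : ℕ) : ℝ)))
    (hb : 0 ≤ b) (hε : 0 ≤ ε) (hx : b * (2 * n) < x₀) {j : ℕ} (hj : j ≤ 2 * n) : gB 0 ≤ gB j := by
  rw [hB 0, hB j]
  have hxj := xB_pos hb hε hx hj
  have hD : ((n - (j - n) : ℕ) : ℝ) ≤ ((n - (0 - n) : ℕ) : ℝ) := by exact_mod_cast (by omega : n - (j - n) ≤ n - (0 - n))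
  have hbj : 0 ≤ b * (j : ℝ) := mul_nonneg hb (Nat.cast_nonneg j)
  have hle : x₀ - b * j + ε * ((n - (j - n) : ℕ) : ℝ) ≤ x₀ - b * ((0 : ℕ) : ℝ) + ε * ((n - (0 - n) : ℕ) : ℝ) := by
    push_cast; nlinarith [mul_le_mul_of_nonneg_left hD hε]
  exact one_div_le_one_div_of_le (Real.sqrt_pos.mpr hxj) (Real.sqrt_le_sqrt hle)


/-- **The depth arithmetic in the start-point form** (the x₀-form of `…HistoryNonuniqueEnd.depth_choice`, restated here so that this module
imports the runs only): for n ≥ 1∕g², n ≥ 4(2b + 2)³∕C², n ≥ 1, 0 ≤ Δ ≤ 1 and x₀ = 1∕g² + b·(2n): `2(x₀ + Δ)√(x₀ + Δ) ≤ C·n²`. [folklore] -/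
theorem depth_bound {b C g Δ x₀ : ℝ} {n : ℕ} (hb : 0 ≤ b) (hC : 0 < C) (hg : 0 < g) (hΔ0 : 0 ≤ Δ) (hΔ1 : Δ ≤ 1)
    (hn1 : 1 ≤ (n : ℝ)) (hng : 1 / g ^ 2 ≤ n) (hnC : 4 * (2 * b + 2) ^ 3 / C ^ 2 ≤ n) (hx₀ : x₀ = 1 / g ^ 2 + b * (2 * n)) :
    2 * (x₀ + Δ) * Real.sqrt (x₀ + Δ) ≤ C * (n : ℝ) ^ 2 := by
  subst hx₀
  set c : ℝ := 2 * b + 2 with hc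
  have hc0 : 0 < c := by rw [hc]; linarith
  have hn0 : 0 < (n : ℝ) := by linarith
  set y : ℝ := 1 / g ^ 2 + b * (2 * n) + Δ with hy
  have hy0 : 0 ≤ y := by rw [hy]; positivity
  have hyc : y ≤ c * n := by rw [hy, hc]; nlinarith
  have hkey : 2 * c * Real.sqrt (c * n) ≤ C * n := by
    have h4 : 4 * c ^ 3 ≤ C ^ 2 * n := by
      have := hnC; rw [div_le_iff₀ (pow_pos hC 2)] at this; linarith
    have hs : Real.sqrt (c * n) ≤ C * n / (2 * c) := by
      rw [Real.sqrt_le_left (by positivity)]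
      rw [div_pow, le_div_iff₀ (by positivity)]
      nlinarith [hn0, hc0]
    calc 2 * c * Real.sqrt (c * n) ≤ 2 * c * (C * n / (2 * c)) := mul_le_mul_of_nonneg_left hs (by positivity)
      _ = C * n := by field_simp
  calc 2 * y * Real.sqrt y ≤ 2 * (c * n) * Real.sqrt (c * n) :=
        mul_le_mul (mul_le_mul_of_nonneg_left hyc (by norm_num)) (Real.sqrt_le_sqrt hyc) (Real.sqrt_nonneg _) (by positivity)
    _ = (2 * c * Real.sqrt (c * n)) * n := by ring
    _ ≤ (C * n) * n := mul_le_mul_of_nonneg_right hkey hn0.le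
    _ = C * (n : ℝ) ^ 2 := by ring

/-! ## §24 The parameter choice for the toy setting -/

/-- **THE DATA OF THE TOY SETTING.**  For b, C, C_p, γ > 0, g ∈ ]0, γ] and a floor N₀ there are a depth parameter n ≥ max(1, N₀), the start
x₀ = 1∕g² + b·2n, an amplitude
ε ∈ ]0, min(b, 1)], a threshold τ > 0, a constant L ≥ 0, the two runs gᴬ, gᴮ of `…HistoryNonuniqueRuns` and M = Σ_{i<n}(gᴬ_i − gᴮ_i) > 0 with:
the modulus conditions ε∕M ≤ C and ε·L ≤ C; the smooth step s ↦ smoothTransition(s∕τ) L-Lipschitz on [0, γ] and equal to 1 at every gᴮ_j,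
j ≤ 2n (τ ≤ gᴮ_0 ≤ gᴮ_j); the `BetaPertH` smallness (ε·n ≤ (5∕4)(x₀ − b·2n), ε ≤ C_p·(gᴬ_0∕3)²); and gᴬ_{2n} = g. [folklore] -/
theorem toyData_exists {b C Cp γ g : ℝ} (hb : 0 < b) (hC : 0 < C) (hCp : 0 < Cp) (hg : 0 < g) (N₀ : ℕ) :
    ∃ (n : ℕ) (x₀ ε M τ L : ℝ) (gA gB : ℕ → ℝ),
      N₀ ≤ n ∧ x₀ = 1 / g ^ 2 + b * (2 * n) ∧
      1 ≤ n ∧ 0 < ε ∧ ε ≤ 1 ∧ ε ≤ b ∧ b * (2 * n) < x₀ ∧ 0 < x₀ ∧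
      (∀ i, gA i = 1 / Real.sqrt (x₀ - b * i)) ∧ (∀ i, gB i = 1 / Real.sqrt (x₀ - b * i + ε * ((n - (i - n) : ℕ) : ℝ))) ∧
      M = ∑ i ∈ range n, (gA i - gB i) ∧ 0 < M ∧ ε / M ≤ C ∧ 0 ≤ L ∧ ε * L ≤ C ∧ 0 < τ ∧
      (∀ j, j ≤ 2 * n → Real.smoothTransition (gB j / τ) = 1) ∧
      (∀ s t : ℝ, s ∈ Set.Icc (0 : ℝ) γ → t ∈ Set.Icc (0 : ℝ) γ →
        |Real.smoothTransition (s / τ) - Real.smoothTransition (t / τ)| ≤ L * |s - t|) ∧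
      ε * n ≤ 5 / 4 * (x₀ - b * (2 * n)) ∧ ε ≤ Cp * (gA 0 / 3) ^ 2 ∧ 0 < gA 0 / 3 ∧ gA (2 * n) = g := by
  -- the depth
  obtain ⟨n, hn⟩ : ∃ n : ℕ, 1 / g ^ 2 + 4 * (2 * b + 2) ^ 3 / C ^ 2 + 1 + N₀ ≤ n := exists_nat_ge _
  have hq0 : 0 ≤ 4 * (2 * b + 2) ^ 3 / C ^ 2 := by positivity
  have hg2 : 0 < 1 / g ^ 2 := by positivity
  have hN0 : (0 : ℝ) ≤ N₀ := Nat.cast_nonneg N₀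
  have hn1 : 1 ≤ (n : ℝ) := by linarith
  have hn1' : 1 ≤ n := by exact_mod_cast hn1
  have hnN : N₀ ≤ n := by exact_mod_cast (show (N₀ : ℝ) ≤ n by linarith)
  have hn0 : 0 < (n : ℝ) := by linarith
  have hng : 1 / g ^ 2 ≤ n := by linarith
  have hnC : 4 * (2 * b + 2) ^ 3 / C ^ 2 ≤ n := by linarith
  -- the start, the threshold, the Lipschitz constant of the step
  set x₀ : ℝ := 1 / g ^ 2 + b * (2 * n) with hx₀
  have hx : b * (2 * n) < x₀ := by rw [hx₀]; linarith
  have hx₀0 : 0 < x₀ := by rw [hx₀]; positivity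
  set τ : ℝ := 1 / Real.sqrt (x₀ + 1) with hτ
  have hτ0 : 0 < τ := by rw [hτ]; positivity
  obtain ⟨L, hL0, hL⟩ := smoothStep_lipschitzOn τ γ
  -- the amplitude
  set ε : ℝ := min (min (min b 1) (1 / n)) (min (min (Cp / (9 * x₀)) (1 / (g ^ 2 * n))) (C / (L + 1))) with hεdef
  have hε0 : 0 < ε := by rw [hεdef]; positivity
  have hεb : ε ≤ b := ((min_le_left _ _).trans (min_le_left _ _)).trans (min_le_left _ _)
  have hε1 : ε ≤ 1 := ((min_le_left _ _).trans (min_le_left _ _)).trans (min_le_right _ _)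
  have hεn : ε ≤ 1 / n := (min_le_left _ _).trans (min_le_right _ _)
  have hεCp : ε ≤ Cp / (9 * x₀) := ((min_le_right _ _).trans (min_le_left _ _)).trans (min_le_left _ _)
  have hεg : ε ≤ 1 / (g ^ 2 * n) := ((min_le_right _ _).trans (min_le_left _ _)).trans (min_le_right _ _)
  have hεL : ε ≤ C / (L + 1) := (min_le_right _ _).trans (min_le_right _ _)
  have hΔ1 : ε * n ≤ 1 := by
    calc ε * n ≤ 1 / n * n := mul_le_mul_of_nonneg_right hεn hn0.le
      _ = 1 := by field_simp
  -- the runs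
  set gA : ℕ → ℝ := fun i => 1 / Real.sqrt (x₀ - b * i) with hgA
  set gB : ℕ → ℝ := fun i => 1 / Real.sqrt (x₀ - b * i + ε * ((n - (i - n) : ℕ) : ℝ)) with hgB
  have hA : ∀ i, gA i = 1 / Real.sqrt (x₀ - b * i) := fun i => rfl
  have hB : ∀ i, gB i = 1 / Real.sqrt (x₀ - b * i + ε * ((n - (i - n) : ℕ) : ℝ)) := fun i => rfl
  set M : ℝ := ∑ i ∈ range n, (gA i - gB i) with hM
  have hMpos : 0 < M := M_pos hA hB hb.le hε0 hx hn1'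
  -- the modulus condition ε∕M ≤ C (as in `…HistoryNonuniqueEnd.exists_twoRuns_uniformModulus`)
  have hεM : ε / M ≤ C := by
    have hMge : (n : ℝ) * (ε * n / (2 * (x₀ + ε * n) * Real.sqrt (x₀ + ε * n))) ≤ M := by
      rw [hM]; exact M_ge hA hB hb.le hε0.le hx
    have hdc : 2 * (x₀ + ε * n) * Real.sqrt (x₀ + ε * n) ≤ C * (n : ℝ) ^ 2 :=
      depth_bound hb.le hC hg (mul_nonneg hε0.le hn0.le) hΔ1 hn1 hng hnC hx₀
    have hD : 0 < 2 * (x₀ + ε * n) * Real.sqrt (x₀ + ε * n) := by positivity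
    rw [div_le_iff₀ hMpos]
    have h1 : ε * ((n : ℝ) * n) ≤ M * (2 * (x₀ + ε * n) * Real.sqrt (x₀ + ε * n)) := by
      have := mul_le_mul_of_nonneg_right hMge hD.le
      rwa [show (n : ℝ) * (ε * n / (2 * (x₀ + ε * n) * Real.sqrt (x₀ + ε * n))) * (2 * (x₀ + ε * n) * Real.sqrt (x₀ + ε * n))
        = ε * ((n : ℝ) * n) by field_simp] at this
    have h2 : ε * ((n : ℝ) * n) ≤ (C * M) * ((n : ℝ) * n) := by nlinarith [h1, mul_le_mul_of_nonneg_left hdc hMpos.le]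
    exact le_of_mul_le_mul_right h2 (by positivity)
  -- ε·L ≤ C
  have hεLC : ε * L ≤ C := by
    have h1 : ε * L ≤ C / (L + 1) * L := mul_le_mul_of_nonneg_right hεL hL0
    have h2 : C / (L + 1) * L ≤ C := by
      rw [div_mul_eq_mul_div, div_le_iff₀ (by linarith)]; nlinarith
    exact h1.trans h2
  -- the threshold sits below run B
  have hτB : ∀ j, j ≤ 2 * n → τ ≤ gB j := by
    intro j hj
    refine le_trans ?_ (gB_ge_start hB hb.le hε0.le hx hj)
    rw [hB 0, hτ]
    have h1 : x₀ - b * ((0 : ℕ) : ℝ) + ε * ((n - (0 - n) : ℕ) : ℝ) ≤ x₀ + 1 := by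
      rw [show n - (0 - n) = n by omega]; push_cast; linarith
    have h0 := xB_pos hb.le hε0.le hx (Nat.zero_le (2 * n))
    exact one_div_le_one_div_of_le (Real.sqrt_pos.mpr h0) (Real.sqrt_le_sqrt h1)
  -- the end point
  have hend : gA (2 * n) = g := by
    rw [hA]; push_cast
    rw [hx₀, show 1 / g ^ 2 + b * (2 * (n : ℝ)) - b * (2 * (n : ℝ)) = (1 / g) ^ 2 by ring, Real.sqrt_sq (by positivity), one_div_one_div]
  -- the `BetaPertH` smallness
  have hΔ54 : ε * n ≤ 5 / 4 * (x₀ - b * (2 * n)) := by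
    have h1 : ε * n ≤ 1 / g ^ 2 := by
      calc ε * n ≤ 1 / (g ^ 2 * n) * n := mul_le_mul_of_nonneg_right hεg hn0.le
        _ = 1 / g ^ 2 := by field_simp
    have h2 : x₀ - b * (2 * n) = 1 / g ^ 2 := by rw [hx₀]; ring
    rw [h2]; linarith
  have hA0 : 0 < gA 0 / 3 := div_pos (gA_pos hA hb.le hx (Nat.zero_le _)) (by norm_num)
  have hεA : ε ≤ Cp * (gA 0 / 3) ^ 2 := by
    have h0 : (gA 0 / 3) ^ 2 = 1 / (9 * x₀) := by
      rw [hA 0]; push_cast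
      rw [mul_zero, sub_zero, div_pow, div_pow, one_pow, Real.sq_sqrt hx₀0.le]; ring
    rw [h0]
    calc ε ≤ Cp / (9 * x₀) := hεCp
      _ = Cp * (1 / (9 * x₀)) := by ring
  exact ⟨n, x₀, ε, M, τ, L, gA, gB, hnN, hx₀, hn1', hε0, hε1, hεb, hx, hx₀0, hA, hB, hM, hMpos, hεM, hL0, hεLC, hτ0,
    fun j hj => smoothStep_eq_one hτ0 (hτB j hj), hL, hΔ54, hεA, hA0, hend⟩

end

end Summit.QuantumFields.BalabanUV.Beta.EriceFlowEnclosureB12AsPrintedHistoryNonuniqueForward
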